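import Mathlib
import Literature.MathematicalPhysics.StatisticalMechanics.Theil2006MinimumDistance
import HarnessLib

/-!
# Crux `EulerZoomLiouville.PowerGaugeEulerLiouville` (stmt-NavierStokesRegularity-19832), width sub-line `chiral_anchor` (ns-idea-11 g10, REV3),
# stub K4 `stub_anchorRace` (THE RACE) — part (a): ELEMENTARY TOOLS

Seat ns-ezl-w3 g8 (`--supports stmt-NavierStokesRegularity-19832 --as helper`).  Pure bookkeeping for the race of the chiral-tube stratum
(`Lines/chiral_anchor.lean`, K4): at each time of the window some dyadic shell HOSTS a fixed fraction `w_j = 1/((j+1)(j+2))` of the conserved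
weighted helicity (finite pigeonhole, `exists_hosting`); the shells decompose ball integrals (`sum_integral_shell`); on a hosting shell the
volume-priced helicity floor forces a quantum `e_j` of local enstrophy (`sq_ge_of_floor`, real arithmetic); and Chebyshev in time over a finite cover
bounds the window length by `Σ_j M_j / e_j` using only OUTER measure — no measurable selection (`measureReal_le_sum_of_cover`).

HONEST FRAMING: tools for one stub of a width sub-line of the MODEL-lattice crux class; nothing about the crux E (19832 OPEN) or NS regularity; not E. [folklore]
-/

noncomputable section

set_option linter.dupNamespace false

open MeasureTheory Set Filter Topology Metric Function
open scoped NNReal ENNReal Topology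

namespace Summit.NavierStokesRegularity.NavierStokesRegularity.Theorems.PowerGaugeEulerLiouville.ChiralAnchor

/-! ### Pigeonhole weights `w_j = 1/((j+1)(j+2))` -/

/-- **Finite pigeonhole (a HOSTING shell exists)**: if `Σ_{j<J} h_j = H₀` (`J ≥ 1`) then some `j < J` has `|H₀|·((j+1)(j+2))⁻¹ ≤ |h_j|`
(weights `Σ ((j+1)(j+2))⁻¹ ≤ 1`: the tree's `Theil2006.sum_range_inv_mul_succ_le_one`). [folklore] -/
theorem exists_hosting {J : ℕ} (hJ : 0 < J) (h : ℕ → ℝ) {H₀ : ℝ}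
    (hsum : ∑ j ∈ Finset.range J, h j = H₀) :
    ∃ j, j < J ∧ |H₀| * (((j : ℝ) + 1) * ((j : ℝ) + 2))⁻¹ ≤ |h j| := by
  by_contra hcon
  push Not at hcon
  have hne : (Finset.range J).Nonempty := ⟨0, Finset.mem_range.2 hJ⟩
  have hlt : ∑ j ∈ Finset.range J, |h j| < ∑ j ∈ Finset.range J, |H₀| * (((j : ℝ) + 1) * ((j : ℝ) + 2))⁻¹ :=
    Finset.sum_lt_sum_of_nonempty hne fun j hj => hcon j (Finset.mem_range.1 hj)
  have hle : ∑ j ∈ Finset.range J, |H₀| * (((j : ℝ) + 1) * ((j : ℝ) + 2))⁻¹ ≤ |H₀| := by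
    rw [← Finset.mul_sum]
    calc |H₀| * ∑ j ∈ Finset.range J, (((j : ℝ) + 1) * ((j : ℝ) + 2))⁻¹ ≤ |H₀| * 1 :=
          mul_le_mul_of_nonneg_left
            (Literature.MathematicalPhysics.StatisticalMechanics.Theil2006.sum_range_inv_mul_succ_le_one J) (abs_nonneg _)
      _ = |H₀| := mul_one _
  have habs : |H₀| ≤ ∑ j ∈ Finset.range J, |h j| := by
    rw [← hsum]; exact Finset.abs_sum_le_sum_abs _ _
  linarith

/-! ### Dyadic shells around the core ball `B(0, 2A)` -/

/-- The `j`-th region `ball 0 (2^{j+1}A) ∩ {j ≠ 0 → 2^j A ≤ ‖x‖}` — the core ball `B(0,2A)` for `j = 0`, the shell `2^j A ≤ ‖x‖ < 2^{j+1} A`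
for `j ≥ 1` — is measurable. [folklore] -/
theorem measurableSet_shell (A : ℝ) (j : ℕ) :
    MeasurableSet (ball (0 : EuclideanSpace ℝ (Fin 3)) (2 ^ (j + 1) * A) ∩ {x | j ≠ 0 → 2 ^ j * A ≤ ‖x‖}) := by
  refine measurableSet_ball.inter ?_
  by_cases hj : j = 0
  · have : {x : EuclideanSpace ℝ (Fin 3) | j ≠ 0 → 2 ^ j * A ≤ ‖x‖} = univ := by
      ext x; simp [hj]
    rw [this]; exact MeasurableSet.univ
  · have : {x : EuclideanSpace ℝ (Fin 3) | j ≠ 0 → 2 ^ j * A ≤ ‖x‖} = {x | 2 ^ j * A ≤ ‖x‖} := by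
      ext x; simp [hj]
    rw [this]; exact measurableSet_le measurable_const measurable_norm

/-- The core region (`j = 0`) is the ball `B(0, 2A)`. -/
theorem shell_zero (A : ℝ) :
    ball (0 : EuclideanSpace ℝ (Fin 3)) (2 ^ (0 + 1) * A) ∩ {x | (0 : ℕ) ≠ 0 → 2 ^ 0 * A ≤ ‖x‖} =
      ball (0 : EuclideanSpace ℝ (Fin 3)) (2 * A) := by
  ext x; simp

/-- For `j ≥ 1` the region is a set difference of balls. -/
theorem shell_of_ne_zero (A : ℝ) {j : ℕ} (hj : j ≠ 0) :
    ball (0 : EuclideanSpace ℝ (Fin 3)) (2 ^ (j + 1) * A) ∩ {x | j ≠ 0 → 2 ^ j * A ≤ ‖x‖} =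
      ball (0 : EuclideanSpace ℝ (Fin 3)) (2 ^ (j + 1) * A) \ ball (0 : EuclideanSpace ℝ (Fin 3)) (2 ^ j * A) := by
  ext x; simp [hj, not_lt]

/-- **Shell decomposition of a ball integral**: `Σ_{j<J} ∫_{shell j} f = ∫_{B(0, 2^J A)} f` for `J ≥ 1` and `f` integrable on the big ball. [folklore] -/
theorem sum_integral_shell {A : ℝ} (hA : 0 ≤ A) {f : EuclideanSpace ℝ (Fin 3) → ℝ} :
    ∀ {J : ℕ}, 0 < J → IntegrableOn f (ball (0 : EuclideanSpace ℝ (Fin 3)) (2 ^ J * A)) →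
      ∑ j ∈ Finset.range J, ∫ x in ball (0 : EuclideanSpace ℝ (Fin 3)) (2 ^ (j + 1) * A) ∩ {x | j ≠ 0 → 2 ^ j * A ≤ ‖x‖}, f x =
        ∫ x in ball (0 : EuclideanSpace ℝ (Fin 3)) (2 ^ J * A), f x := by
  intro J hJ hf
  induction J with
  | zero => exact absurd hJ (lt_irrefl 0)
  | succ n ih =>
    rcases Nat.eq_zero_or_pos n with rfl | hn
    · simp
    · have hsub : ball (0 : EuclideanSpace ℝ (Fin 3)) (2 ^ n * A) ⊆ ball (0 : EuclideanSpace ℝ (Fin 3)) (2 ^ (n + 1) * A) :=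
        ball_subset_ball (mul_le_mul_of_nonneg_right (pow_le_pow_right₀ one_le_two (Nat.le_succ n)) hA)
      rw [Finset.sum_range_succ, ih hn (hf.mono_set hsub), shell_of_ne_zero A hn.ne', setIntegral_sdiff measurableSet_ball hf hsub]
      ring

/-! ### The hosting floor (real arithmetic) -/

/-- **A hosting shell pays a quantum of enstrophy**: from the floor `wH ≤ C V^{1/3} (D + R⁻¹ a) K`, `K ≤ κ D` and the `A`-gauge `a ≤ √c₁ R^{1/2−ρ}`:
`min(wH/(2CκV^{1/3}), (wH)² R^{1+2ρ}/(4C²κ²c₁V^{2/3})) ≤ D²`. [folklore] -/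
theorem sq_ge_of_floor {C κ V c₁ R w H D a K ρ : ℝ} (hC : 0 < C) (hκ : 0 < κ) (hV : 0 < V) (hc₁ : 0 < c₁) (hR : 0 < R)
    (hw : 0 < w) (hH : 0 < H) (hD : 0 ≤ D) (hK : 0 ≤ K)
    (h1 : w * H ≤ C * V ^ (1 / 3 : ℝ) * (D + R⁻¹ * a) * K) (h2 : K ≤ κ * D) (h3 : a ≤ Real.sqrt c₁ * R ^ (1 / 2 - ρ)) :
    min (w * H / (2 * C * κ * V ^ (1 / 3 : ℝ))) ((w * H) ^ 2 * R ^ (1 + 2 * ρ) / (4 * C ^ 2 * κ ^ 2 * c₁ * V ^ (2 / 3 : ℝ))) ≤ D ^ 2 := by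
  set b : ℝ := Real.sqrt c₁ * R ^ (-(1 / 2) - ρ) with hbdef
  set M : ℝ := C * κ * V ^ (1 / 3 : ℝ) with hMdef
  have hV3 : 0 < V ^ (1 / 3 : ℝ) := Real.rpow_pos_of_pos hV _
  have hM : 0 < M := by positivity
  have hb0 : 0 ≤ b := by positivity
  have hba : R⁻¹ * a ≤ b := by
    have : R⁻¹ * (Real.sqrt c₁ * R ^ (1 / 2 - ρ)) = b := by
      rw [hbdef, show (-(1 / 2) - ρ : ℝ) = (1 / 2 - ρ) - 1 by ring, Real.rpow_sub_one hR.ne']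
      field_simp
    rw [← this]
    exact mul_le_mul_of_nonneg_left h3 (inv_nonneg.2 hR.le)
  -- `wH ≤ M (D² + b D)`
  have hmain : w * H ≤ M * (D ^ 2 + b * D) := by
    calc w * H ≤ C * V ^ (1 / 3 : ℝ) * (D + R⁻¹ * a) * K := h1
      _ ≤ C * V ^ (1 / 3 : ℝ) * (D + b) * K := by gcongr
      _ ≤ C * V ^ (1 / 3 : ℝ) * (D + b) * (κ * D) := by
          have : 0 ≤ C * V ^ (1 / 3 : ℝ) * (D + b) := by positivity
          exact mul_le_mul_of_nonneg_left h2 this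
      _ = M * (D ^ 2 + b * D) := by rw [hMdef]; ring
  by_cases hcase : b * D ≤ D ^ 2
  · -- `wH ≤ 2 M D²`
    refine (min_le_left _ _).trans ?_
    have h2M : w * H ≤ 2 * M * D ^ 2 := by nlinarith
    rw [show 2 * C * κ * V ^ (1 / 3 : ℝ) = 2 * M by rw [hMdef]; ring]
    rw [div_le_iff₀ (by positivity)]
    linarith
  · -- `D² < b D`: then `D < b`, `wH ≤ 2 M b D`
    refine (min_le_right _ _).trans ?_
    rw [not_le] at hcase
    have hDpos : 0 < D := by
      rcases hD.eq_or_lt with h | h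
      · rw [← h] at hcase; simp at hcase
      · exact h
    have hbpos : 0 < b := by
      by_contra h'
      have : b = 0 := le_antisymm (not_lt.1 h') hb0
      rw [this, zero_mul] at hcase
      exact absurd hcase (not_lt.2 (sq_nonneg D))
    have h2 : w * H ≤ 2 * M * b * D := by nlinarith
    have h3' : w * H / (2 * M * b) ≤ D := by rw [div_le_iff₀ (by positivity)]; linarith
    have h4 : (w * H / (2 * M * b)) ^ 2 ≤ D ^ 2 := pow_le_pow_left₀ (by positivity) h3' 2
    refine le_trans (le_of_eq ?_) h4
    have hb2 : b ^ 2 = c₁ * (R ^ (1 + 2 * ρ))⁻¹ := by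
      rw [hbdef, mul_pow, Real.sq_sqrt hc₁.le, ← Real.rpow_natCast, ← Real.rpow_mul hR.le, ← Real.rpow_neg hR.le]
      norm_num
      left
      congr 1
      ring
    have hM2 : M ^ 2 = C ^ 2 * κ ^ 2 * V ^ (2 / 3 : ℝ) := by
      rw [hMdef, mul_pow, mul_pow, ← Real.rpow_natCast (V ^ (1 / 3 : ℝ)), ← Real.rpow_mul hV.le]
      norm_num
    have hR' : 0 < R ^ (1 + 2 * ρ) := Real.rpow_pos_of_pos hR _
    have hV' : 0 < V ^ (2 / 3 : ℝ) := Real.rpow_pos_of_pos hV _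
    rw [div_pow, show (2 * M * b) ^ 2 = 4 * M ^ 2 * b ^ 2 by ring, hM2, hb2]
    field_simp

/-! ### Chebyshev in time over a finite cover (outer measure only) -/

/-- **The window is short**: if every `σ ∈ W` has some `j < J` with `e_j ≤ G_j(σ)` (`e_j > 0`) and `∫_W G_j ≤ M_j`, then `|W| ≤ Σ_{j<J} M_j/e_j`.
Only the outer measure of the (possibly non-measurable) hosting sets enters. [folklore] -/
theorem measureReal_le_sum_of_cover {W : Set ℝ} (hW : MeasurableSet W) {J : ℕ} {G : ℕ → ℝ → ℝ≥0∞}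
    (hG : ∀ j, j < J → AEMeasurable (G j) (volume.restrict W)) {e M : ℕ → ℝ} (he : ∀ j, j < J → 0 < e j)
    (hM : ∀ j, j < J → 0 ≤ M j) (hint : ∀ j, j < J → ∫⁻ σ in W, G j σ ≤ ENNReal.ofReal (M j))
    (hcover : ∀ σ ∈ W, ∃ j, j < J ∧ ENNReal.ofReal (e j) ≤ G j σ) :
    (volume W).toReal ≤ ∑ j ∈ Finset.range J, M j / e j := by
  have hsub : W ⊆ ⋃ j ∈ Finset.range J, ({σ | ENNReal.ofReal (e j) ≤ G j σ} ∩ W) := by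
    intro σ hσ
    obtain ⟨j, hj, hje⟩ := hcover σ hσ
    exact mem_biUnion (Finset.mem_range.2 hj) ⟨hje, hσ⟩
  have heach : ∀ j ∈ Finset.range J, volume ({σ | ENNReal.ofReal (e j) ≤ G j σ} ∩ W) ≤ ENNReal.ofReal (M j / e j) := by
    intro j hj
    have hj' := Finset.mem_range.1 hj
    rw [← Measure.restrict_apply' hW, ENNReal.ofReal_div_of_pos (he j hj')]
    have hmk := mul_meas_ge_le_lintegral₀ (hG j hj') (ENNReal.ofReal (e j))
    have he0 : ENNReal.ofReal (e j) ≠ 0 := by rw [ENNReal.ofReal_ne_zero_iff]; exact he j hj'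
    rw [ENNReal.le_div_iff_mul_le (Or.inl he0) (Or.inl ENNReal.ofReal_ne_top), mul_comm]
    exact hmk.trans (hint j hj')
  have h1 : volume W ≤ ∑ j ∈ Finset.range J, ENNReal.ofReal (M j / e j) :=
    (measure_mono hsub).trans ((measure_biUnion_finset_le _ _).trans (Finset.sum_le_sum heach))
  rw [← ENNReal.ofReal_sum_of_nonneg fun j hj => div_nonneg (hM j (Finset.mem_range.1 hj)) (he j (Finset.mem_range.1 hj)).le] at h1
  exact ENNReal.toReal_le_of_le_ofReal
    (Finset.sum_nonneg fun j hj => div_nonneg (hM j (Finset.mem_range.1 hj)) (he j (Finset.mem_range.1 hj)).le) h1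

end Summit.NavierStokesRegularity.NavierStokesRegularity.Theorems.PowerGaugeEulerLiouville.ChiralAnchor

end
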